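import Mathlib
import Literature.NumberTheory.Transcendental.AssociatorsDefectSeriesProofs
import HarnessLib

/-!
# Associators XIII: the cocycle identity of the lowest hexagon defect

Proofs file towards [Furusho2010, Thm 1] (`furusho_pentagon_hexagon`), third step of the
inductive cocycle argument. Let `φ` be a group-like solution of the pentagon over a commutative
`ℚ`-algebra `k`, `μ ∈ k`, and suppose the first hexagon equation holds at all levels `< m`.
By `AssociatorsDefectSeriesProofs` the defect series `Ψ = 𝒢 - ℰ` has no terms of degree `< m`,
so in `U𝔞₄ ⊗ k/(deg > m)` every value `Ψ(a, b)` (`a, b` weight-one) lies in the top weight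
`wFil m`, where it is absorbed by factors from `1 + wFil 1` (`u Ψ(a,b) u' = Ψ(a,b)`).
Feeding the four images of the level-`m` hexagon words under the cabling/permutation maps
`d₀, d₁, (2 3), (0 1 2 3)` into the pentagon coherence identity of `AssociatorsCoherenceProofs`
and absorbing, the exponential terms cancel and what remains is

  **the cocycle identity** `Ψ(x₀ + x₁, x₂) + Ψ(x₀, x₁) = Ψ(x₀, x₁ + x₂) + Ψ(x₁, x₂)`,
  `x_i = t_{i3}` (`NCSeries.cocycle_DK`),

an identity in the subalgebra generated by the chords through strand `3`; transported by the
`S₄`-action and the retraction `rep(·)(1)` of `AssociatorsFreeRepProofs` it becomes the same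
identity in the free truncated algebra `k⟨x₀,x₁,x₂⟩/(deg > m)` (`NCSeries.cocycle_free`). This is
the 2-cocycle condition of the normalised cochain complex `n ↦ k⟨x₁,…,x_n⟩` of the free-algebra
functor (faces: doubling a variable, inserting a variable), whose vanishing in bidegree
`(2, m ≥ 3)` is proved in the next file.

No named facts are introduced.

## References

* H. Furusho, *Pentagon and hexagon equations*, Ann. of Math. 171 (2010), 545–556. [Furusho2010]
* V. G. Drinfel'd, Leningrad Math. J. 2 (1991), §5 (hexagon and pentagon as identities between
  cabling morphisms). [Drinfeld1991]
-/

noncomputable section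

open scoped BigOperators

namespace Literature.NumberTheory.Transcendental

universe u

namespace NCSeries

section Cocycle

variable {k : Type u} [CommRing k] [Algebra ℚ k] {N : ℕ}

local notation "𝔱" => (DrinfeldKohnoTrunc.t k N : Fin 4 → Fin 4 → DrinfeldKohnoTrunc k (Fin 4) N)

local notation "𝔈" x => truncExp k N x

/-! ## 1. Images of the level-`N` hexagon word `𝒢(t₀₂,t₁₂)` under algebra endomorphisms -/

/-- The image of `𝒢(t₀₂, t₁₂)` under an algebra endomorphism `F` is `𝒢(F t₀₂, F t₁₂)`, i.e. the
explicit hexagon word at the arguments `F t₀₂, F t₀₁, F t₁₂`. [folklore] -/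
theorem map_hexagon_word {φ : NCSeries Bool k} (hg : IsGroupLike φ) (h0 : φ [false] = 0)
    (h1 : φ [true] = 0) (h2 : φ * swapXY φ = 1 ∧ swapXY φ * φ = 1) (μ : k)
    (F : DrinfeldKohnoTrunc k (Fin 4) N →ₐ[k] DrinfeldKohnoTrunc k (Fin 4) N) :
    evalTrunc N (bsub (F (𝔱 0 2)) (F (𝔱 0 1))) φ * (𝔈 (((1 / 2 : ℚ) • μ) • F (𝔱 0 2))) *
          Ring.inverse (evalTrunc N (bsub (F (𝔱 0 2)) (F (𝔱 1 2))) φ) *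
        (𝔈 (((1 / 2 : ℚ) • μ) • F (𝔱 1 2))) * evalTrunc N (bsub (F (𝔱 0 1)) (F (𝔱 1 2))) φ =
      evalTrunc N (bsub (F (𝔱 0 2)) (F (𝔱 1 2))) (hexG μ φ) := by
  have h := congrArg F (hexagon_rhs_eq_evalTrunc_hexG (N := N) hg h0 h1 h2 μ)
  have hu : IsUnit (evalTrunc N (bsub (𝔱 0 2) (𝔱 1 2)) φ) :=
    isUnit_subst₂ hg.1 (DrinfeldKohnoTrunc.t_mem_genSpan 0 2) (DrinfeldKohnoTrunc.t_mem_genSpan 1 2)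
  rw [map_mul, map_mul, map_mul, map_mul, map_ringInverse_of_isUnit F hu,
    DrinfeldKohnoTrunc.expT_eq_truncExp, DrinfeldKohnoTrunc.expT_eq_truncExp, map_truncExp,
    map_truncExp, map_smul, map_smul, algHom_evalTrunc_bsub, algHom_evalTrunc_bsub,
    algHom_evalTrunc_bsub, algHom_evalTrunc_bsub] at h
  exact h

/-- `𝒢(a, b) = ℰ(a, b) + Ψ(a, b)`. [folklore] -/
theorem evalTrunc_hexG_eq_add {A : Type*} [Ring A] [Algebra k A] (n : ℕ) (v : Bool → A) (μ : k)
    (φ : NCSeries Bool k) :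
    evalTrunc n v (hexG μ φ) = evalTrunc n v (hexE μ) + evalTrunc n v (hexDefect μ φ) := by
  rw [evalTrunc_hexDefect]; abel

/-- `Ψ(a, b) ∈ wFil m` for weight-one `a, b` when `Ψ` has no terms of degree `< m`. [folklore] -/
theorem evalTrunc_hexDefect_mem_wFil {φ : NCSeries Bool k} {μ : k} {m : ℕ}
    (hlow : ∀ w : List Bool, w.length < m → hexDefect μ φ w = 0)
    {a b : DrinfeldKohnoTrunc k (Fin 4) N}
    (ha : a ∈ (DrinfeldKohnoTrunc.genSpan : Submodule k (DrinfeldKohnoTrunc k (Fin 4) N)))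
    (hb : b ∈ (DrinfeldKohnoTrunc.genSpan : Submodule k (DrinfeldKohnoTrunc k (Fin 4) N))) :
    evalTrunc N (bsub a b) (hexDefect μ φ) ∈
      (DrinfeldKohnoTrunc.wFil m : Submodule k (DrinfeldKohnoTrunc k (Fin 4) N)) :=
  evalTrunc_mem_wFil hlow _ fun c => by cases c <;> assumption

/-- `ℰ(a, b) = e^{μ(a+b)/2}` in `U𝔞₄ ⊗ k/(deg > N)`, weight-one arguments. [folklore] -/
theorem evalTrunc_hexE_DK {a b : DrinfeldKohnoTrunc k (Fin 4) N}
    (ha : a ∈ (DrinfeldKohnoTrunc.genSpan : Submodule k (DrinfeldKohnoTrunc k (Fin 4) N)))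
    (hb : b ∈ (DrinfeldKohnoTrunc.genSpan : Submodule k (DrinfeldKohnoTrunc k (Fin 4) N))) (μ : k) :
    evalTrunc N (bsub a b) (hexE μ) = 𝔈 (((1 / 2 : ℚ) • μ) • (a + b)) :=
  evalTrunc_hexE _ genSpan_prod_eq_zero ha hb μ

/-! ## 2. The cocycle identity in `U𝔞₄ ⊗ k/(deg > m)` -/

/-- **The cocycle identity of the lowest hexagon defect** (level `N = m`): for a group-like
solution `φ` of the pentagon and `μ ∈ k` such that the first hexagon holds at all levels `< m`,
the defect series `Ψ = 𝒢 - ℰ` satisfies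
`Ψ(x₀ + x₁, x₂) + Ψ(x₀, x₁) = Ψ(x₀, x₁ + x₂) + Ψ(x₁, x₂)` with `x_i = t_{i3}` in
`U𝔞₄ ⊗ k/(deg > m)`. Proof: the coherence identity `W_α = W_β` of `AssociatorsCoherenceProofs`;
`W_α = 𝒢(x₀+x₁, x₂) + Ψ(x₀, x₁)` and `W_β = e^{μ(x₀+x₁+x₂)/2} + Ψ(x₀, x₁+x₂) + Ψ(x₁, x₂)` by the four
instances (cablings `d₀, d₁`, permutations `(2 3)`, `(0 1 2 3)`) of the level-`m` hexagon word,
`𝒢 = ℰ + Ψ`, and absorption of the top weight `wFil m ∋ Ψ(·,·)`. (A step of the elementary proof of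
[Furusho2010, Thm 1] formalised in this series; not taken from the printed sources.) [folklore] -/
theorem cocycle_DK {φ : NCSeries Bool k} (hg : IsGroupLike φ) (hP : DrinfeldPentagon φ) (μ : k)
    (hH : ∀ n : ℕ, n < N → HexAt μ φ n) :
    evalTrunc N (bsub (𝔱 0 3 + 𝔱 1 3) (𝔱 2 3)) (hexDefect μ φ) +
        evalTrunc N (bsub (𝔱 0 3) (𝔱 1 3)) (hexDefect μ φ) =
      evalTrunc N (bsub (𝔱 0 3) (𝔱 1 3 + 𝔱 2 3)) (hexDefect μ φ) +
        evalTrunc N (bsub (𝔱 1 3) (𝔱 2 3)) (hexDefect μ φ) := by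
  have h0 : φ [false] = 0 := hP.apply_letter_eq_zero_of_isGroupLike hg false
  have h1 : φ [true] = 0 := hP.apply_letter_eq_zero_of_isGroupLike hg true
  have h2 := hP.two_cycle hg
  have hlow : ∀ w : List Bool, w.length < N → hexDefect μ φ w = 0 := fun w hw =>
    hexDefect_apply_eq_zero_of_forall_lt hg h0 h1 h2 hH hw
  -- memberships
  have m01 := DrinfeldKohnoTrunc.t_mem_genSpan (R := k) (N := N) (0 : Fin 4) 1
  have m03 := DrinfeldKohnoTrunc.t_mem_genSpan (R := k) (N := N) (0 : Fin 4) 3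
  have m12 := DrinfeldKohnoTrunc.t_mem_genSpan (R := k) (N := N) (1 : Fin 4) 2
  have m13 := DrinfeldKohnoTrunc.t_mem_genSpan (R := k) (N := N) (1 : Fin 4) 3
  have m23 := DrinfeldKohnoTrunc.t_mem_genSpan (R := k) (N := N) (2 : Fin 4) 3
  have m0313 := DrinfeldKohnoTrunc.t_add_t_mem_genSpan (R := k) (N := N) 0 3 1 3
  have m0212 := DrinfeldKohnoTrunc.t_add_t_mem_genSpan (R := k) (N := N) 0 2 1 2
  have m0102 := DrinfeldKohnoTrunc.t_add_t_mem_genSpan (R := k) (N := N) 0 1 0 2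
  have m1323 := DrinfeldKohnoTrunc.t_add_t_mem_genSpan (R := k) (N := N) 1 3 2 3
  -- the four instances of the hexagon word
  have iA := map_hexagon_word (N := N) hg h0 h1 h2 μ (DrinfeldKohnoTrunc.permHom DrinfeldKohnoTrunc.s₂₃)
  have iC := map_hexagon_word (N := N) hg h0 h1 h2 μ (DrinfeldKohnoTrunc.permHom DrinfeldKohnoTrunc.cyc)
  have i0 := map_hexagon_word (N := N) hg h0 h1 h2 μ (DrinfeldKohnoTrunc.d₀ k N)
  have i1 := map_hexagon_word (N := N) hg h0 h1 h2 μ (DrinfeldKohnoTrunc.d₁ k N)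
  simp only [DrinfeldKohnoTrunc.permHom_t, DrinfeldKohnoTrunc.s₂₃_0, DrinfeldKohnoTrunc.s₂₃_1,
    DrinfeldKohnoTrunc.s₂₃_2, DrinfeldKohnoTrunc.cyc_0, DrinfeldKohnoTrunc.cyc_1,
    DrinfeldKohnoTrunc.cyc_2, DrinfeldKohnoTrunc.d₀_t01, DrinfeldKohnoTrunc.d₀_t02,
    DrinfeldKohnoTrunc.d₀_t12, DrinfeldKohnoTrunc.d₁_t01, DrinfeldKohnoTrunc.d₁_t02,
    DrinfeldKohnoTrunc.d₁_t12] at iA iC i0 i1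
  -- split `𝒢 = ℰ + Ψ` in the instances
  rw [evalTrunc_hexG_eq_add, evalTrunc_hexE_DK m03 m13] at iA
  rw [evalTrunc_hexG_eq_add, evalTrunc_hexE_DK m13 m23] at iC
  rw [evalTrunc_hexG_eq_add, evalTrunc_hexE_DK m0313 m23] at i0
  rw [evalTrunc_hexG_eq_add, evalTrunc_hexE_DK m03 m1323] at i1
  -- names for the four defect values and the exponentials
  set eA := evalTrunc N (bsub (𝔱 0 3) (𝔱 1 3)) (hexDefect μ φ)
  set eC := evalTrunc N (bsub (𝔱 1 3) (𝔱 2 3)) (hexDefect μ φ)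
  set e0 := evalTrunc N (bsub (𝔱 0 3 + 𝔱 1 3) (𝔱 2 3)) (hexDefect μ φ)
  set e1 := evalTrunc N (bsub (𝔱 0 3) (𝔱 1 3 + 𝔱 2 3)) (hexDefect μ φ)
  have hA : eA ∈ (DrinfeldKohnoTrunc.wFil N : Submodule k (DrinfeldKohnoTrunc k (Fin 4) N)) :=
    evalTrunc_hexDefect_mem_wFil hlow m03 m13
  have hC : eC ∈ (DrinfeldKohnoTrunc.wFil N : Submodule k (DrinfeldKohnoTrunc k (Fin 4) N)) :=
    evalTrunc_hexDefect_mem_wFil hlow m13 m23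
  have hE1 : e1 ∈ (DrinfeldKohnoTrunc.wFil N : Submodule k (DrinfeldKohnoTrunc k (Fin 4) N)) :=
    evalTrunc_hexDefect_mem_wFil hlow m03 m1323
  -- the coherence identity, with `truncExp` for `expT`
  have coh := hP.coherence (N := N) hg.1 μ
  simp only [DrinfeldKohnoTrunc.expT_eq_truncExp] at coh
  rw [iA, iC] at coh
  -- factors in `1 + wFil 1`
  have u_b : evalTrunc N (bsub (𝔱 0 3 + 𝔱 1 3) (𝔱 0 2 + 𝔱 1 2)) φ - 1 ∈
      (DrinfeldKohnoTrunc.wFil 1 : Submodule k (DrinfeldKohnoTrunc k (Fin 4) N)) :=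
    evalTrunc_sub_one_mem_wFil hg.1 _ fun c => by cases c <;> assumption
  have u_g : evalTrunc N (bsub (𝔱 0 3 + 𝔱 1 3) (𝔱 2 3)) φ - 1 ∈
      (DrinfeldKohnoTrunc.wFil 1 : Submodule k (DrinfeldKohnoTrunc k (Fin 4) N)) :=
    evalTrunc_sub_one_mem_wFil hg.1 _ fun c => by cases c <;> assumption
  obtain ⟨-, -, u_ig⟩ := DrinfeldKohnoTrunc.ring_inverse_of_sub_one_mem_wFil u_g
  have u_h : evalTrunc N (bsub (𝔱 0 2 + 𝔱 1 2) (𝔱 2 3)) φ - 1 ∈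
      (DrinfeldKohnoTrunc.wFil 1 : Submodule k (DrinfeldKohnoTrunc k (Fin 4) N)) :=
    evalTrunc_sub_one_mem_wFil hg.1 _ fun c => by cases c <;> assumption
  have u_E23 : (𝔈 (((1 / 2 : ℚ) • μ) • 𝔱 2 3)) - 1 ∈
      (DrinfeldKohnoTrunc.wFil 1 : Submodule k (DrinfeldKohnoTrunc k (Fin 4) N)) :=
    DrinfeldKohnoTrunc.truncExp_sub_one_mem_wFil (Submodule.smul_mem _ _ m23)
  have u_a : evalTrunc N (bsub (𝔱 0 1) (𝔱 1 2)) φ - 1 ∈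
      (DrinfeldKohnoTrunc.wFil 1 : Submodule k (DrinfeldKohnoTrunc k (Fin 4) N)) :=
    evalTrunc_sub_one_mem_wFil hg.1 _ fun c => by cases c <;> assumption
  obtain ⟨-, ia_a, u_ia⟩ := DrinfeldKohnoTrunc.ring_inverse_of_sub_one_mem_wFil u_a
  have u_i : evalTrunc N (bsub (𝔱 0 3) (𝔱 0 1 + 𝔱 0 2)) φ - 1 ∈
      (DrinfeldKohnoTrunc.wFil 1 : Submodule k (DrinfeldKohnoTrunc k (Fin 4) N)) :=
    evalTrunc_sub_one_mem_wFil hg.1 _ fun c => by cases c <;> assumption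
  have u_E03 : (𝔈 (((1 / 2 : ℚ) • μ) • 𝔱 0 3)) - 1 ∈
      (DrinfeldKohnoTrunc.wFil 1 : Submodule k (DrinfeldKohnoTrunc k (Fin 4) N)) :=
    DrinfeldKohnoTrunc.truncExp_sub_one_mem_wFil (Submodule.smul_mem _ _ m03)
  have u_j : evalTrunc N (bsub (𝔱 0 3) (𝔱 1 3 + 𝔱 2 3)) φ - 1 ∈
      (DrinfeldKohnoTrunc.wFil 1 : Submodule k (DrinfeldKohnoTrunc k (Fin 4) N)) :=
    evalTrunc_sub_one_mem_wFil hg.1 _ fun c => by cases c <;> assumption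
  obtain ⟨-, -, u_ij⟩ := DrinfeldKohnoTrunc.ring_inverse_of_sub_one_mem_wFil u_j
  have u_o : evalTrunc N (bsub (𝔱 0 1 + 𝔱 0 2) (𝔱 1 3 + 𝔱 2 3)) φ - 1 ∈
      (DrinfeldKohnoTrunc.wFil 1 : Submodule k (DrinfeldKohnoTrunc k (Fin 4) N)) :=
    evalTrunc_sub_one_mem_wFil hg.1 _ fun c => by cases c <;> assumption
  have u_pre : Ring.inverse (evalTrunc N (bsub (𝔱 0 1) (𝔱 1 2)) φ) *
        evalTrunc N (bsub (𝔱 0 3) (𝔱 0 1 + 𝔱 0 2)) φ * (𝔈 (((1 / 2 : ℚ) • μ) • 𝔱 0 3)) *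
        Ring.inverse (evalTrunc N (bsub (𝔱 0 3) (𝔱 1 3 + 𝔱 2 3)) φ) - 1 ∈
      (DrinfeldKohnoTrunc.wFil 1 : Submodule k (DrinfeldKohnoTrunc k (Fin 4) N)) :=
    DrinfeldKohnoTrunc.mul_sub_one_mem_wFil
      (DrinfeldKohnoTrunc.mul_sub_one_mem_wFil (DrinfeldKohnoTrunc.mul_sub_one_mem_wFil u_ia u_i)
        u_E03) u_ij
  have hle : N ≤ N := le_rfl
  -- absorption rewrites
  have aA1 := DrinfeldKohnoTrunc.mul_eq_right_of_wFil hle u_b hA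
  have aA2 := DrinfeldKohnoTrunc.mul_eq_left_of_wFil hle u_ig hA
  have aA3 := DrinfeldKohnoTrunc.mul_eq_left_of_wFil hle u_E23 hA
  have aA4 := DrinfeldKohnoTrunc.mul_eq_left_of_wFil hle u_h hA
  have aC1 := DrinfeldKohnoTrunc.mul_eq_right_of_wFil hle u_pre hC
  have aC2 := DrinfeldKohnoTrunc.mul_eq_left_of_wFil hle u_o hC
  have aC3 := DrinfeldKohnoTrunc.mul_eq_left_of_wFil hle u_a hC
  have a11 := DrinfeldKohnoTrunc.mul_eq_right_of_wFil hle u_ia hE1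
  have a12 := DrinfeldKohnoTrunc.mul_eq_left_of_wFil hle u_a hE1
  -- the central exponential commutes with `φ(t₀₁, t₁₂)`
  have hT : Commute (𝔈 (((1 / 2 : ℚ) • μ) • (𝔱 0 3 + (𝔱 1 3 + 𝔱 2 3))))
      (evalTrunc N (bsub (𝔱 0 1) (𝔱 1 2)) φ) := by
    have c01 : Commute (𝔱 0 3 + (𝔱 1 3 + 𝔱 2 3)) (𝔱 0 1) := by
      rw [show 𝔱 0 3 + (𝔱 1 3 + 𝔱 2 3) = (𝔱 0 3 + 𝔱 1 3) + 𝔱 2 3 by abel]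
      exact DrinfeldKohnoTrunc.commute_t01_t03_add_t13.symm.add_left
        DrinfeldKohnoTrunc.commute_t01_t23.symm
    have c12 : Commute (𝔱 0 3 + (𝔱 1 3 + 𝔱 2 3)) (𝔱 1 2) := by
      rw [show 𝔱 0 3 + (𝔱 1 3 + 𝔱 2 3) = (𝔱 1 3 + 𝔱 2 3) + 𝔱 0 3 by abel]
      exact DrinfeldKohnoTrunc.commute_t12_t13_add_t23.symm.add_left
        DrinfeldKohnoTrunc.commute_t03_t12
    have h := commute_expT_evalTrunc μ c01 c12 φ
    rw [DrinfeldKohnoTrunc.expT_eq_truncExp] at h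
    exact h
  -- `W_α = 𝒢(x₀+x₁, x₂) + Ψ(x₀, x₁)`
  have Wα : evalTrunc N (bsub (𝔱 0 3 + 𝔱 1 3) (𝔱 0 2 + 𝔱 1 2)) φ *
        ((𝔈 (((1 / 2 : ℚ) • μ) • (𝔱 0 3 + 𝔱 1 3))) + eA) *
        Ring.inverse (evalTrunc N (bsub (𝔱 0 3 + 𝔱 1 3) (𝔱 2 3)) φ) *
        (𝔈 (((1 / 2 : ℚ) • μ) • 𝔱 2 3)) * evalTrunc N (bsub (𝔱 0 2 + 𝔱 1 2) (𝔱 2 3)) φ =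
      (𝔈 (((1 / 2 : ℚ) • μ) • (𝔱 0 3 + 𝔱 1 3 + 𝔱 2 3))) + e0 + eA := by
    have split : evalTrunc N (bsub (𝔱 0 3 + 𝔱 1 3) (𝔱 0 2 + 𝔱 1 2)) φ *
          ((𝔈 (((1 / 2 : ℚ) • μ) • (𝔱 0 3 + 𝔱 1 3))) + eA) *
          Ring.inverse (evalTrunc N (bsub (𝔱 0 3 + 𝔱 1 3) (𝔱 2 3)) φ) *
          (𝔈 (((1 / 2 : ℚ) • μ) • 𝔱 2 3)) * evalTrunc N (bsub (𝔱 0 2 + 𝔱 1 2) (𝔱 2 3)) φ =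
        evalTrunc N (bsub (𝔱 0 3 + 𝔱 1 3) (𝔱 0 2 + 𝔱 1 2)) φ *
            (𝔈 (((1 / 2 : ℚ) • μ) • (𝔱 0 3 + 𝔱 1 3))) *
            Ring.inverse (evalTrunc N (bsub (𝔱 0 3 + 𝔱 1 3) (𝔱 2 3)) φ) *
            (𝔈 (((1 / 2 : ℚ) • μ) • 𝔱 2 3)) * evalTrunc N (bsub (𝔱 0 2 + 𝔱 1 2) (𝔱 2 3)) φ +
          evalTrunc N (bsub (𝔱 0 3 + 𝔱 1 3) (𝔱 0 2 + 𝔱 1 2)) φ * eA *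
            Ring.inverse (evalTrunc N (bsub (𝔱 0 3 + 𝔱 1 3) (𝔱 2 3)) φ) *
            (𝔈 (((1 / 2 : ℚ) • μ) • 𝔱 2 3)) * evalTrunc N (bsub (𝔱 0 2 + 𝔱 1 2) (𝔱 2 3)) φ := by
      simp only [mul_add, add_mul]
    rw [split, aA1, aA2, aA3, aA4, i0]
  -- `W_β = e^{μ(x₀+x₁+x₂)/2} + Ψ(x₀, x₁+x₂) + Ψ(x₁, x₂)`
  have Wβ : Ring.inverse (evalTrunc N (bsub (𝔱 0 1) (𝔱 1 2)) φ) *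
        evalTrunc N (bsub (𝔱 0 3) (𝔱 0 1 + 𝔱 0 2)) φ * (𝔈 (((1 / 2 : ℚ) • μ) • 𝔱 0 3)) *
        Ring.inverse (evalTrunc N (bsub (𝔱 0 3) (𝔱 1 3 + 𝔱 2 3)) φ) *
        ((𝔈 (((1 / 2 : ℚ) • μ) • (𝔱 1 3 + 𝔱 2 3))) + eC) *
        evalTrunc N (bsub (𝔱 0 1 + 𝔱 0 2) (𝔱 1 3 + 𝔱 2 3)) φ *
        evalTrunc N (bsub (𝔱 0 1) (𝔱 1 2)) φ =
      (𝔈 (((1 / 2 : ℚ) • μ) • (𝔱 0 3 + (𝔱 1 3 + 𝔱 2 3)))) + e1 + eC := by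
    have split : Ring.inverse (evalTrunc N (bsub (𝔱 0 1) (𝔱 1 2)) φ) *
          evalTrunc N (bsub (𝔱 0 3) (𝔱 0 1 + 𝔱 0 2)) φ * (𝔈 (((1 / 2 : ℚ) • μ) • 𝔱 0 3)) *
          Ring.inverse (evalTrunc N (bsub (𝔱 0 3) (𝔱 1 3 + 𝔱 2 3)) φ) *
          ((𝔈 (((1 / 2 : ℚ) • μ) • (𝔱 1 3 + 𝔱 2 3))) + eC) *
          evalTrunc N (bsub (𝔱 0 1 + 𝔱 0 2) (𝔱 1 3 + 𝔱 2 3)) φ *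
          evalTrunc N (bsub (𝔱 0 1) (𝔱 1 2)) φ =
        Ring.inverse (evalTrunc N (bsub (𝔱 0 1) (𝔱 1 2)) φ) *
            (evalTrunc N (bsub (𝔱 0 3) (𝔱 0 1 + 𝔱 0 2)) φ * (𝔈 (((1 / 2 : ℚ) • μ) • 𝔱 0 3)) *
              Ring.inverse (evalTrunc N (bsub (𝔱 0 3) (𝔱 1 3 + 𝔱 2 3)) φ) *
              (𝔈 (((1 / 2 : ℚ) • μ) • (𝔱 1 3 + 𝔱 2 3))) *
              evalTrunc N (bsub (𝔱 0 1 + 𝔱 0 2) (𝔱 1 3 + 𝔱 2 3)) φ) *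
            evalTrunc N (bsub (𝔱 0 1) (𝔱 1 2)) φ +
          Ring.inverse (evalTrunc N (bsub (𝔱 0 1) (𝔱 1 2)) φ) *
            evalTrunc N (bsub (𝔱 0 3) (𝔱 0 1 + 𝔱 0 2)) φ * (𝔈 (((1 / 2 : ℚ) • μ) • 𝔱 0 3)) *
            Ring.inverse (evalTrunc N (bsub (𝔱 0 3) (𝔱 1 3 + 𝔱 2 3)) φ) * eC *
            evalTrunc N (bsub (𝔱 0 1 + 𝔱 0 2) (𝔱 1 3 + 𝔱 2 3)) φ *
            evalTrunc N (bsub (𝔱 0 1) (𝔱 1 2)) φ := by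
      simp only [mul_add, add_mul, mul_assoc]
    rw [split, aC1, aC2, aC3, i1, mul_add, add_mul, a11, a12, mul_assoc, hT.eq, ← mul_assoc, ia_a,
      one_mul]
  -- combine with the coherence identity
  rw [Wα, Wβ] at coh
  exact add_left_cancel (a := (𝔈 (((1 / 2 : ℚ) • μ) • (𝔱 0 3 + (𝔱 1 3 + 𝔱 2 3)))))
    (b := e0 + eA) (c := e1 + eC) (by simpa only [add_assoc] using coh)

/-! ## 3. Transport to the free truncated algebra on three letters -/

/-- The permutation `0 ↦ 0, 1 ↦ 2, 2 ↦ 3, 3 ↦ 1` making strand `3` the distinguished strand `1` of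
`AssociatorsFreeRepProofs`. [folklore] -/
def τ₃₁ : Equiv.Perm (Fin 4) := ⟨![0, 2, 3, 1], ![0, 3, 1, 2], by decide, by decide⟩

/-- Values of `τ₃₁`. [folklore] -/
@[simp] theorem τ₃₁_0 : τ₃₁ 0 = 0 := rfl
/-- Values of `τ₃₁`. [folklore] -/
@[simp] theorem τ₃₁_1 : τ₃₁ 1 = 2 := rfl
/-- Values of `τ₃₁`. [folklore] -/
@[simp] theorem τ₃₁_2 : τ₃₁ 2 = 3 := rfl
/-- Values of `τ₃₁`. [folklore] -/
@[simp] theorem τ₃₁_3 : τ₃₁ 3 = 1 := rfl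

omit [Algebra ℚ k] in
/-- Transport of `Ψ(A, B)` by the retraction for explicit coefficient vectors (a conditional form
of `rep_eval_vec_one` avoiding rewrites inside the arguments). [folklore] -/
theorem rep_eval_of_eq (ψ : NCSeries Bool k) (a₁ b₁ c₁ a₂ b₂ c₂ : k)
    {A B : DrinfeldKohnoTrunc k (Fin 4) N} (hA : A = a₁ • 𝔱 0 1 + b₁ • 𝔱 1 2 + c₁ • 𝔱 1 3)
    (hB : B = a₂ • 𝔱 0 1 + b₂ • 𝔱 1 2 + c₂ • 𝔱 1 3) :
    rep k N (evalTrunc N (bsub A B) ψ) 1 =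
      evalTrunc N (bsub (a₁ • xg N 0 + b₁ • xg N 1 + c₁ • xg N 2)
        (a₂ • xg N 0 + b₂ • xg N 1 + c₂ • xg N 2)) ψ := by
  subst hA; subst hB
  exact rep_eval_vec_one a₁ b₁ c₁ a₂ b₂ c₂

/-- **The cocycle identity in the free truncated algebra `k⟨x₀,x₁,x₂⟩/(deg > m)`**:
`Ψ(x₀ + x₁, x₂) + Ψ(x₀, x₁) = Ψ(x₀, x₁ + x₂) + Ψ(x₁, x₂)` for the letter classes `x_c`
(transport of `NCSeries.cocycle_DK` by the permutation `τ₃₁` and the retraction `rep(·)(1)`).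
[folklore] -/
theorem cocycle_free {φ : NCSeries Bool k} (hg : IsGroupLike φ) (hP : DrinfeldPentagon φ) (μ : k)
    (hH : ∀ n : ℕ, n < N → HexAt μ φ n) :
    evalTrunc N (bsub (xg (k := k) N 0 + xg N 1) (xg N 2)) (hexDefect μ φ) +
        evalTrunc N (bsub (xg (k := k) N 0) (xg N 1)) (hexDefect μ φ) =
      evalTrunc N (bsub (xg (k := k) N 0) (xg N 1 + xg N 2)) (hexDefect μ φ) +
        evalTrunc N (bsub (xg (k := k) N 1) (xg N 2)) (hexDefect μ φ) := by
  have h := congrArg (DrinfeldKohnoTrunc.permHom (R := k) (N := N) τ₃₁) (cocycle_DK hg hP μ hH)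
  simp only [map_add, algHom_evalTrunc_bsub, DrinfeldKohnoTrunc.permHom_t, τ₃₁_0, τ₃₁_1, τ₃₁_2,
    τ₃₁_3, DrinfeldKohnoTrunc.t_21, DrinfeldKohnoTrunc.t_31] at h
  have h' := congrArg (fun z : DrinfeldKohnoTrunc k (Fin 4) N =>
    rep k N z (1 : NCSeries (Fin 3) k ⧸ truncIdeal (Fin 3) k N)) h
  simp only [map_add, LinearMap.add_apply] at h'
  rw [rep_eval_of_eq (hexDefect μ φ) 1 1 0 0 0 1 (A := 𝔱 0 1 + 𝔱 1 2) (B := 𝔱 1 3) (by simp) (by simp),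
    rep_eval_of_eq (hexDefect μ φ) 1 0 0 0 1 0 (A := 𝔱 0 1) (B := 𝔱 1 2) (by simp) (by simp),
    rep_eval_of_eq (hexDefect μ φ) 1 0 0 0 1 1 (A := 𝔱 0 1) (B := 𝔱 1 2 + 𝔱 1 3) (by simp) (by simp),
    rep_eval_of_eq (hexDefect μ φ) 0 1 0 0 0 1 (A := 𝔱 1 2) (B := 𝔱 1 3) (by simp) (by simp)] at h'
  simpa using h'

end Cocycle

end NCSeries

end Literature.NumberTheory.Transcendental
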